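import Summits.Schanuel.Schanuel.Theorems.ZilberEacRotatingPower
import Summits.Schanuel.Schanuel.Theorems.ZilberEacHyperplaneSlowExistence
import Summits.Schanuel.Schanuel.Theorems.ZilberEacRealHyperplaneInvariant
import HarnessLib

/-!
# Real hyperplanes in the slow regime: Zariski density for EVERY growth exponent (O53 (a))

Zilber's Exponential-Algebraic Closedness, case ladder (host summit Schanuel, cell `pub-schanuel`,
seat 2, gen 12).  THE FAMILY (`s ≥ 0`, `r ∈ ℝ^{s+1}`, `c ∈ ℂ`, `Aⱼ ∈ ℂ[x₀..x_s]`, `Fⱼ ∈ ℂ[u]`):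

  `W = {x_{s+1} = Σ rᵢ xᵢ + c,  yⱼ = Aⱼ(x) + y_{s+1} Fⱼ(y_{s+1}) (j ≤ s)} ⊆ ℂ^{s+2} × ℂ^{s+2}`

in the slow regime `λ + max(λ,0) deg Fⱼ < dⱼ = deg Aⱼ`, `λ = Σ rᵢ dᵢ`.  Earlier density theorems needed
`λ ∉ ℚ` (THEOREM J, `ZilberEacRealHyperplaneDensity`) or an INTEGER RELATION `Σ rᵢ qᵢ = 0` with
`d ∝ q` (rotation on the invariant direction, `ZilberEacRealHyperplaneInvariant`); O49 (a) / O53 (a)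
recorded the rational-`λ` families without an integer relation as open.

**THEOREM (`unprojectedDense_polyFibredGraph_hyperplane`).**  If some `rᵢ ∉ ℚ` (equivalently: `W` is
additively free), every `Aⱼ ≠ 0` and the slow-regime inequality holds, then `I(W ∩ Γ_exp) = I(W)` —
for EVERY real `λ`, rational or not, with or without integer relations.  This supersedes both earlier
theorems in the slow regime: over real hyperplanes, slow regime, membership in the cell (some
`rᵢ ∉ ℚ`) already forces Zariski density.

Proof: pick ONE lattice direction `q` with `θ = Σ rᵢ qᵢ ∉ ℚ` and all leading forms non-vanishing at
`2πi q` (`exists_int_irrational_sum_eval_ne_zero`: `{q : r·q ∉ ℚ} ∪ ({q : r·q ∉ ℚ} - eᵢ) = ℤ^{s+1}`);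
labelled existence (`exists_solutions_hyperplane_slow`) gives `x(m) = ρ(m) + (log m) d + 2πi m q`,
`ρ(m) → 2πi p + log a`, whence `y_{s+1} = e^{ℓ(x(m))} = e^{c + r·ρ(m)} m^{λ} e^{2πiθ m}`: THEOREM M
(`ZilberEacRotatingPower`) with `ζ = e^{2πiθ}` and the plain density of the labels.

Corollaries: `polyFibredGraph_hyperplane_member_dense` (certified members, every `s`), and the
example of O53 (a) with `λ = 1/2 ∈ ℚ` and NO integer relation: **`sqrtTwoHalf_member_dense`** —
`{x₂ = √2 x₀ + (1/2 - √2) x₁, y₀ = x₀ + y₂, y₁ = x₁ + y₂} ⊆ ℂ³ × ℂ³` is a certified member of `EC(3,2)`,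
not linearly split, meets `Γ_exp`, DENSE (`sqrtTwoHalf_no_integer_relation`: `Σ rᵢqᵢ = 0 ⟹ q = 0`).

HONEST FRAMING: explicit families inside an OPEN cell; the critical case `λ(1 + deg Fⱼ) = dⱼ` and the
mixed regime with `ν ∈ ℚ` stay open; `EC(3,2)` OPEN; NOT Schanuel's conjecture; EAC ⇏ SC.
-/

noncomputable section

open Complex MvPolynomial Filter Topology
open Literature.NumberTheory.Transcendental Literature.ModelTheory.Zilber
  Literature.ModelTheory.ExponentialFields

set_option linter.dupNamespace false

namespace Summit.Schanuel.Schanuel.Theorems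

/-! ## Part A. A lattice direction with irrational `r·q` off a hypersurface -/

section Direction

variable {t : ℕ}

/-- Evaluating a translate: `(bind₁ (X + C κ) G)(x) = G(x + κ)`. [folklore] -/
theorem eval_bind₁_translate (G : MvPolynomial (Fin t) ℂ) (κ x : Fin t → ℂ) :
    eval x (bind₁ (fun i => X i + C (κ i)) G) = eval (x + κ) G := by
  change eval₂Hom (RingHom.id ℂ) x (bind₁ _ G) = _
  rw [eval₂Hom_bind₁]
  have : (fun i => eval₂Hom (RingHom.id ℂ) x (X i + C (κ i) : MvPolynomial (Fin t) ℂ)) = x + κ := by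
    funext i; simp
  rw [this]
  rfl

/-- Translating the variables is injective on `ℂ[X₁..X_t]`. [folklore] -/
theorem bind₁_translate_ne_zero {G : MvPolynomial (Fin t) ℂ} (hG : G ≠ 0) (κ : Fin t → ℂ) :
    bind₁ (fun i => X i + C (κ i)) G ≠ 0 := by
  intro h
  apply hG
  apply MvPolynomial.funext
  intro x
  rw [map_zero]
  have := eval_bind₁_translate G κ (x - κ)
  rw [h, map_zero, sub_add_cancel] at this
  exact this.symm

/-- **A lattice direction with `Σ rᵢ qᵢ ∉ ℚ` off a hypersurface.**  If some `rᵢ` is irrational and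
`L ≠ 0`, `a ≠ 0`, there is `q ∈ ℤ^t` with `Σ rᵢ qᵢ` irrational and `L(a q) ≠ 0`: for `M = L · L(· + a eᵢ)`
some `q` has `M(aq) ≠ 0`, and one of `q`, `q + eᵢ` has an irrational `r`-value. [folklore] -/
theorem exists_int_irrational_sum_eval_ne_zero {L : MvPolynomial (Fin t) ℂ} (hL : L ≠ 0) {a : ℂ}
    (ha : a ≠ 0) (r : Fin t → ℝ) (hr : ∃ i, Irrational (r i)) :
    ∃ q : Fin t → ℤ, Irrational (∑ j, r j * (q j : ℝ)) ∧ eval (fun j => a * (q j : ℂ)) L ≠ 0 := by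
  classical
  obtain ⟨i, hi⟩ := hr
  set q₀ : Fin t → ℤ := fun j => if j = i then 1 else 0 with hq₀
  have hsum₀ : ∀ q : Fin t → ℤ, ∑ j, r j * ((q j + q₀ j : ℤ) : ℝ) = ∑ j, r j * (q j : ℝ) + r i := by
    intro q
    have : ∀ j, r j * ((q j + q₀ j : ℤ) : ℝ) = r j * (q j : ℝ) + (if j = i then r j else 0) := by
      intro j
      simp only [hq₀]
      split_ifs with h
      · push_cast; ring
      · push_cast; ring
    rw [Finset.sum_congr rfl fun j _ => this j, Finset.sum_add_distrib, Finset.sum_ite_eq']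
    simp
  set Ls : MvPolynomial (Fin t) ℂ := bind₁ (fun j => X j + C (a * (q₀ j : ℂ))) L with hLs
  have hLs0 : Ls ≠ 0 := bind₁_translate_ne_zero hL _
  obtain ⟨q, hq⟩ := exists_int_eval_ne_zero (mul_ne_zero hL hLs0) ha
  rw [map_mul] at hq
  have h1 : eval (fun j => a * (q j : ℂ)) L ≠ 0 := left_ne_zero_of_mul hq
  have h2 : eval (fun j => a * ((q j + q₀ j : ℤ) : ℂ)) L ≠ 0 := by
    have h := right_ne_zero_of_mul hq
    rw [hLs, eval_bind₁_translate] at h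
    have e : ((fun j => a * (q j : ℂ)) + fun j => a * (q₀ j : ℂ)) =
        fun j => a * ((q j + q₀ j : ℤ) : ℂ) := by
      funext j; simp only [Pi.add_apply]; push_cast; ring
    rwa [e] at h
  by_cases hirr : Irrational (∑ j, r j * (q j : ℝ))
  · exact ⟨q, hirr, h1⟩
  · refine ⟨fun j => q j + q₀ j, ?_, h2⟩
    rw [hsum₀]
    obtain ⟨ρ, hρ⟩ : ∃ ρ : ℚ, (ρ : ℝ) = ∑ j, r j * (q j : ℝ) := by
      simpa [Irrational] using hirr
    rw [← hρ]
    exact hi.ratCast_add (q := ρ)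

end Direction

/-! ## Part B. Density over real hyperplanes in the slow regime, all growth exponents -/

section Density

variable {s : ℕ}

/-- `Σ rᵢ (ρ + L d + Y q)ᵢ = Σ rᵢ ρᵢ + L Σ rᵢ dᵢ + Y Σ rᵢ qᵢ`. [folklore] -/
theorem sum_mul_add_smul_add_smul (r : Fin (s + 1) → ℝ) (ρ d q : Fin (s + 1) → ℂ) (L Y : ℂ) :
    ∑ i, (r i : ℂ) * (ρ + L • d + Y • q) i =
      ∑ i, (r i : ℂ) * ρ i + L * ∑ i, (r i : ℂ) * d i + Y * ∑ i, (r i : ℂ) * q i := by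
  have h : ∀ i, (r i : ℂ) * (ρ + L • d + Y • q) i =
      (r i : ℂ) * ρ i + L * ((r i : ℂ) * d i) + Y * ((r i : ℂ) * q i) := by
    intro i
    simp only [Pi.add_apply, Pi.smul_apply, smul_eq_mul]
    ring
  simp only [h, Finset.sum_add_distrib, Finset.mul_sum]

/-- **THEOREM (Zariski density over real hyperplanes, slow regime, EVERY growth exponent).**
See the module docstring: some `rᵢ ∉ ℚ`, every `Aⱼ ≠ 0`, `λ + max(λ,0) deg Fⱼ < deg Aⱼ` for all `j`
(`λ = Σ rᵢ deg Aᵢ` an arbitrary real number) ⟹ `I(W ∩ Γ_exp) = I(W)` for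
`W = polyFibredGraph (Σ rᵢXᵢ + c) A (Fⱼ(u))`. (new)
[cite: MantovaMasser2023, §1 p.5 (the open case dim π(V) = 2 in ℂ³×ℂˣ³)] -/
theorem unprojectedDense_polyFibredGraph_hyperplane (r : Fin (s + 1) → ℝ) (c : ℂ)
    (hr : ∃ i, Irrational (r i))
    (A : Fin (s + 1) → MvPolynomial (Fin (s + 1)) ℂ) (hA0 : ∀ j, A j ≠ 0)
    (F : Fin (s + 1) → Polynomial ℂ)
    (hlam : ∀ j, (∑ i, r i * (A i).totalDegree) +
      max (∑ i, r i * (A i).totalDegree) 0 * ((F j).natDegree : ℝ) < (A j).totalDegree) :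
    UnprojectedDense (polyFibredGraph (hyperplanePoly r c) A (fun j => (F j).toMvPolynomial 0)) := by
  classical
  -- one good direction: leading forms non-vanishing, `θ = Σ rᵢ qᵢ` irrational
  set Lp : MvPolynomial (Fin (s + 1)) ℂ := ∏ j, homogeneousComponent (A j).totalDegree (A j) with hLp
  have hLp0 : Lp ≠ 0 := Finset.prod_ne_zero_iff.2 fun j _ =>
    ExpDominant.homogeneousComponent_totalDegree_ne_zero (hA0 j)
  obtain ⟨q, hθirr, hqL⟩ := exists_int_irrational_sum_eval_ne_zero hLp0 Complex.two_pi_I_ne_zero r hr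
  have hA : ∀ j, eval (fun i => 2 * Real.pi * I * (q i : ℂ))
      (homogeneousComponent (A j).totalDegree (A j)) ≠ 0 := by
    rw [hLp, map_prod] at hqL
    exact fun j => (Finset.prod_ne_zero_iff.1 hqL) j (Finset.mem_univ j)
  set θ : ℝ := ∑ j, r j * (q j : ℝ) with hθ
  set lam : ℝ := ∑ i, r i * (A i).totalDegree with hlamdef
  set ζ : ℂ := exp (2 * Real.pi * I * (θ : ℂ)) with hζ
  have hζ1 : ‖ζ‖ = 1 := by
    rw [hζ, show (2 * Real.pi * I * (θ : ℂ)) = ((2 * Real.pi * θ : ℝ) : ℂ) * I by push_cast; ring]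
    exact Complex.norm_exp_ofReal_mul_I _
  have hroot : ∀ j : ℕ, 0 < j → ζ ^ j ≠ 1 := exp_two_pi_I_mul_pow_ne_one hθirr
  -- the labels
  set Llog : Fin (s + 1) → ℂ := fun j => log (eval (fun i => 2 * Real.pi * I * (q i : ℂ))
    (homogeneousComponent (A j).totalDegree (A j))) with hLlog
  refine unprojectedDense_of_rotating_power (t := s + 1)
    (isIrreducibleClosed_polyFibredGraph _ A _) (by rw [zariskiDim_polyFibredGraph])
    (fun i => Sum.inl (Fin.castSucc i)) (Sum.inr (Fin.last (s + 1)))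
    (fun j => (((A j).totalDegree : ℕ) : ℂ)) (fun j => (q j : ℂ)) lam hζ1 hroot
    (U := {ρ | ∃ p : Fin (s + 1) → ℤ, ρ = fun j => 2 * Real.pi * I * (p j : ℂ) + Llog j})
    (fun G hG => ?_) ?_
  · obtain ⟨pv, hpv⟩ := exists_int_eval_translate_ne_zero hG Llog (a := 2 * Real.pi * I)
      Complex.two_pi_I_ne_zero
    refine ⟨_, ⟨pv, rfl⟩, ?_⟩
    have e : (fun j => 2 * Real.pi * I * (pv j : ℂ) + Llog j) =
        fun i => Llog i + 2 * Real.pi * I * (pv i : ℂ) := by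
      funext i; ring
    rwa [e]
  rintro ρ₀ ⟨p, rfl⟩
  obtain ⟨x, ρ, hsol, hx, hρ⟩ := exists_solutions_hyperplane_slow r c q A hA F hlam p
  -- the points, the sequences
  set P : ℕ → Fin (s + 2) ⊕ Fin (s + 2) → ℂ := fun m =>
    pgParam (hyperplanePoly r c) A (fun j => (F j).toMvPolynomial 0) (x m)
      (exp (∑ i, (r i : ℂ) * x m i + c)) with hP
  set C : ℕ → ℂ := fun m => exp (c + ∑ i, (r i : ℂ) * ρ m i) with hC
  have hexpm : ∀ m : ℕ, 1 ≤ m → exp (((Real.log m : ℝ)) : ℂ) = (m : ℂ) := by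
    intro m hm
    rw [← Complex.ofReal_exp, Real.exp_log (by exact_mod_cast hm)]
    push_cast
    rfl
  refine ⟨P, fun m => ρ m + ((Real.log m : ℝ) : ℂ) • (fun j => (((A j).totalDegree : ℕ) : ℂ)),
    fun m => Real.log m, fun m => 2 * Real.pi * I * (m : ℂ),
    fun m => 2 * Real.pi * I * (m : ℂ) / exp (((Real.log m : ℝ)) : ℂ), C, 2 * Real.pi * I,
    exp (c + ∑ i, (r i : ℂ) * (2 * Real.pi * I * (p i : ℂ) + Llog i)),
    ?_, ?_, ?_, ?_, fun m => ?_, ?_, Complex.two_pi_I_ne_zero, ?_, ?_, Complex.exp_ne_zero _⟩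
  · -- points of `W ∩ Γ_exp`
    filter_upwards [hsol] with m hm
    exact ⟨pgParam_mem _ _ _ _ _, pgParam_hyperplane_mem_expGraph r c A F hm⟩
  · -- the `x`-coordinates
    filter_upwards with m
    have hcoord : (fun i => P m (Sum.inl (Fin.castSucc i))) = x m := by
      funext i; simp [hP]
    rw [hcoord, hx m]
  · exact Real.tendsto_log_atTop.comp tendsto_natCast_atTop_atTop
  · -- the transversal part converges
    refine hρ.congr fun m => ?_
    simp only [add_sub_cancel_right]
  · rw [mul_div_cancel₀ _ (Complex.exp_ne_zero _)]
  · -- `Y(m) = 2πi` eventually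
    refine tendsto_const_nhds.congr' ?_
    filter_upwards [eventually_ge_atTop 1] with m hm
    rw [hexpm m hm, mul_div_cancel_right₀ _ (by exact_mod_cast (show m ≠ 0 by omega))]
  · -- the power coordinate `e^{ℓ(x(m))} = m^{λ} ζ^m C(m)`
    filter_upwards with m
    have hβ : P m (Sum.inr (Fin.last (s + 1))) = exp (∑ i, (r i : ℂ) * x m i + c) := by
      simp [hP]
    rw [hβ, hζ, hC, ← Complex.exp_nat_mul, ← Complex.exp_add, ← Complex.exp_add, hx m,
      sum_mul_add_smul_add_smul]
    congr 1
    have h1 : (((lam * Real.log m : ℝ)) : ℂ) =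
        ((Real.log m : ℝ) : ℂ) * ∑ i, (r i : ℂ) * (((A i).totalDegree : ℕ) : ℂ) := by
      rw [hlamdef]; push_cast; ring
    have h2 : (m : ℂ) * (2 * Real.pi * I * (θ : ℂ)) =
        2 * Real.pi * I * (m : ℂ) * ∑ i, (r i : ℂ) * (q i : ℂ) := by
      rw [hθ]; push_cast; ring
    rw [h1, h2]
    ring
  · -- `C(m) → C₀`
    exact ((Complex.continuous_exp.comp (continuous_const.add (continuous_finsetSum _
      fun i _ => continuous_const.mul (continuous_apply i)))).tendsto _).comp hρ

/-- **Certified members of the open cell with dense exponential points (every `λ`).**  `A`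
dominant (`aeval A` injective), some `rᵢ ∉ ℚ`, `Fⱼ ∈ ℂ[u]` in the slow regime: all seven hypotheses
of `ECCell (s+2) (s+1)`, not linearly split, `W ∩ Γ_exp ≠ ∅`, `I(W ∩ Γ_exp) = I(W)`. (new)
[cite: MantovaMasser2023, §1 p.5 (the open case dim π(V) = 2 in ℂ³×ℂˣ³)] -/
theorem polyFibredGraph_hyperplane_member_dense (r : Fin (s + 1) → ℝ) (c : ℂ)
    (hr : ∃ i, Irrational (r i)) (A : Fin (s + 1) → MvPolynomial (Fin (s + 1)) ℂ)
    (hAinj : Function.Injective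
      (aeval A : MvPolynomial (Fin (s + 1)) ℂ →ₐ[ℂ] MvPolynomial (Fin (s + 1)) ℂ))
    (F : Fin (s + 1) → Polynomial ℂ)
    (hlam : ∀ j, (∑ i, r i * (A i).totalDegree) +
      max (∑ i, r i * (A i).totalDegree) 0 * ((F j).natDegree : ℝ) < (A j).totalDegree) :
    (IsIrreducibleClosed ℂ (polyFibredGraph (hyperplanePoly r c) A (fun j => (F j).toMvPolynomial 0)) ∧
      (polyFibredGraph (hyperplanePoly r c) A (fun j => (F j).toMvPolynomial 0) ∩
        torusLocus ℂ (s + 2)).Nonempty ∧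
      IsRotund ℂ (s + 2) (polyFibredGraph (hyperplanePoly r c) A (fun j => (F j).toMvPolynomial 0) ∩
        torusLocus ℂ (s + 2)) ∧
      IsAddFree ℂ (s + 2) (polyFibredGraph (hyperplanePoly r c) A (fun j => (F j).toMvPolynomial 0) ∩
        torusLocus ℂ (s + 2)) ∧
      IsMulFree ℂ (s + 2) (polyFibredGraph (hyperplanePoly r c) A (fun j => (F j).toMvPolynomial 0) ∩
        torusLocus ℂ (s + 2)) ∧
      zariskiDim ℂ (polyFibredGraph (hyperplanePoly r c) A (fun j => (F j).toMvPolynomial 0)) =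
        (s + 2 : ℕ) ∧
      addProjDim ℂ (s + 2) (polyFibredGraph (hyperplanePoly r c) A (fun j => (F j).toMvPolynomial 0)) =
        (s + 1 : ℕ)) ∧
    ¬ IsLinearSplit ℂ (s + 2) (polyFibredGraph (hyperplanePoly r c) A (fun j => (F j).toMvPolynomial 0)) ∧
    (polyFibredGraph (hyperplanePoly r c) A (fun j => (F j).toMvPolynomial 0) ∩
      expGraph ℂ (s + 2)).Nonempty ∧
    UnprojectedDense (polyFibredGraph (hyperplanePoly r c) A (fun j => (F j).toMvPolynomial 0)) := by
  have hA0 : ∀ j, A j ≠ 0 := by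
    intro j hj
    have h : (aeval A : MvPolynomial (Fin (s + 1)) ℂ →ₐ[ℂ] MvPolynomial (Fin (s + 1)) ℂ) (X j) =
        (aeval A : MvPolynomial (Fin (s + 1)) ℂ →ₐ[ℂ] MvPolynomial (Fin (s + 1)) ℂ) 0 := by
      rw [aeval_X, hj, map_zero]
    exact X_ne_zero j (hAinj h)
  have hcell := ecCell_hypotheses_polyFibredGraph_hyperplane r c A (fun j => (F j).toMvPolynomial 0)
    hAinj hr
  have hdense := unprojectedDense_polyFibredGraph_hyperplane r c hr A hA0 F hlam
  refine ⟨hcell, not_isLinearSplit_polyFibredGraph _ A _ (Nat.succ_pos s) hAinj, ?_, hdense⟩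
  obtain ⟨w, hw, -⟩ := hcell.2.1
  exact inter_expGraph_nonempty_of_vanishingIdeal_eq ⟨w, hw⟩ hdense

end Density

/-! ## Part C. The example of O53 (a): `x₂ = √2 x₀ + (1/2 - √2) x₁`, `yⱼ = xⱼ + y₂` -/

section Example

/-- The coefficient vector `(√2, 1/2 - √2)` has NO integer relation: `√2 q₀ + (1/2 - √2) q₁ = 0`
forces `q = 0` (so the base is invariant under no lattice direction and
`ZilberEacRealHyperplaneInvariant` does not apply), while `λ = √2 + (1/2 - √2) = 1/2 ∈ ℚ`
(so THEOREM J / `ZilberEacRealHyperplaneDensity` does not apply). [folklore] -/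
theorem sqrtTwoHalf_no_integer_relation (q : Fin 2 → ℤ)
    (h : ∑ i, (![Real.sqrt 2, 1 / 2 - Real.sqrt 2] : Fin 2 → ℝ) i * (q i : ℝ) = 0) : q = 0 := by
  rw [Fin.sum_univ_two] at h
  simp only [Matrix.cons_val_zero, Matrix.cons_val_one] at h
  have hq01 : q 0 = q 1 := by
    by_contra hne
    have hne' : ((q 0 : ℝ) - (q 1 : ℝ)) ≠ 0 := by
      rw [sub_ne_zero]; exact_mod_cast hne
    apply irrational_sqrt_two
    refine ⟨-((q 1 : ℚ) / 2) / ((q 0 : ℚ) - (q 1 : ℚ)), ?_⟩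
    push_cast
    rw [div_eq_iff hne']
    linarith
  have h1 : (q 1 : ℝ) = 0 := by
    have : Real.sqrt 2 * (q 0 : ℝ) + (1 / 2 - Real.sqrt 2) * (q 1 : ℝ) = (1 / 2) * (q 1 : ℝ) := by
      rw [show ((q 0 : ℤ) : ℝ) = ((q 1 : ℤ) : ℝ) by exact_mod_cast hq01]; ring
    rw [this] at h
    linarith
  have h1' : q 1 = 0 := by exact_mod_cast h1
  funext i
  fin_cases i
  · simp [hq01, h1']
  · simp [h1']

/-- **The rational-`λ`, relation-free example of O53 (a) is dense.**
`W = {x₂ = √2x₀ + (1/2 - √2)x₁, y₀ = x₀ + y₂, y₁ = x₁ + y₂} ⊆ ℂ³ × ℂ³`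
(`e^z = z + e^{√2z + (1/2-√2)w}`, `e^w = w + e^{√2z + (1/2-√2)w}`; `λ = 1/2 ∈ ℚ`, no integer relation):
all seven hypotheses of `ECCell 3 2`, not linearly split, `W ∩ Γ_exp ≠ ∅` AND `I(W ∩ Γ_exp) = I(W)`.
(new) [cite: MantovaMasser2023, §1 p.5 (the open case dim π(V) = 2 in ℂ³×ℂˣ³)] -/
theorem sqrtTwoHalf_member_dense :
    (IsIrreducibleClosed ℂ (polyFibredGraph (hyperplanePoly ![Real.sqrt 2, 1 / 2 - Real.sqrt 2] 0)
        (fun j => X j) (fun _ => (1 : Polynomial ℂ).toMvPolynomial 0)) ∧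
      (polyFibredGraph (hyperplanePoly ![Real.sqrt 2, 1 / 2 - Real.sqrt 2] 0) (fun j => X j)
          (fun _ => (1 : Polynomial ℂ).toMvPolynomial 0) ∩ torusLocus ℂ 3).Nonempty ∧
      IsRotund ℂ 3 (polyFibredGraph (hyperplanePoly ![Real.sqrt 2, 1 / 2 - Real.sqrt 2] 0)
          (fun j => X j) (fun _ => (1 : Polynomial ℂ).toMvPolynomial 0) ∩ torusLocus ℂ 3) ∧
      IsAddFree ℂ 3 (polyFibredGraph (hyperplanePoly ![Real.sqrt 2, 1 / 2 - Real.sqrt 2] 0)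
          (fun j => X j) (fun _ => (1 : Polynomial ℂ).toMvPolynomial 0) ∩ torusLocus ℂ 3) ∧
      IsMulFree ℂ 3 (polyFibredGraph (hyperplanePoly ![Real.sqrt 2, 1 / 2 - Real.sqrt 2] 0)
          (fun j => X j) (fun _ => (1 : Polynomial ℂ).toMvPolynomial 0) ∩ torusLocus ℂ 3) ∧
      zariskiDim ℂ (polyFibredGraph (hyperplanePoly ![Real.sqrt 2, 1 / 2 - Real.sqrt 2] 0)
          (fun j => X j) (fun _ => (1 : Polynomial ℂ).toMvPolynomial 0)) = (3 : ℕ) ∧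
      addProjDim ℂ 3 (polyFibredGraph (hyperplanePoly ![Real.sqrt 2, 1 / 2 - Real.sqrt 2] 0)
          (fun j => X j) (fun _ => (1 : Polynomial ℂ).toMvPolynomial 0)) = (2 : ℕ)) ∧
    ¬ IsLinearSplit ℂ 3 (polyFibredGraph (hyperplanePoly ![Real.sqrt 2, 1 / 2 - Real.sqrt 2] 0)
        (fun j => X j) (fun _ => (1 : Polynomial ℂ).toMvPolynomial 0)) ∧
    (polyFibredGraph (hyperplanePoly ![Real.sqrt 2, 1 / 2 - Real.sqrt 2] 0) (fun j => X j)
        (fun _ => (1 : Polynomial ℂ).toMvPolynomial 0) ∩ expGraph ℂ 3).Nonempty ∧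
    UnprojectedDense (polyFibredGraph (hyperplanePoly ![Real.sqrt 2, 1 / 2 - Real.sqrt 2] 0)
        (fun j => X j) (fun _ => (1 : Polynomial ℂ).toMvPolynomial 0)) := by
  have hA : Function.Injective (aeval (fun j : Fin 2 => (X j : MvPolynomial (Fin 2) ℂ)) :
      MvPolynomial (Fin 2) ℂ →ₐ[ℂ] MvPolynomial (Fin 2) ℂ) := by
    rw [aeval_X_left]; exact fun _ _ h => h
  have hdeg : ∀ j : Fin 2, (X j : MvPolynomial (Fin 2) ℂ).totalDegree = 1 := fun j => totalDegree_X j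
  have hsum : (∑ i : Fin 2, (![Real.sqrt 2, 1 / 2 - Real.sqrt 2] : Fin 2 → ℝ) i *
      ((X i : MvPolynomial (Fin 2) ℂ).totalDegree : ℝ)) = 1 / 2 := by
    rw [Fin.sum_univ_two, hdeg, hdeg]
    simp
  have hlam : ∀ j : Fin 2, (∑ i : Fin 2, (![Real.sqrt 2, 1 / 2 - Real.sqrt 2] : Fin 2 → ℝ) i *
      ((X i : MvPolynomial (Fin 2) ℂ).totalDegree : ℝ)) +
      max (∑ i : Fin 2, (![Real.sqrt 2, 1 / 2 - Real.sqrt 2] : Fin 2 → ℝ) i *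
        ((X i : MvPolynomial (Fin 2) ℂ).totalDegree : ℝ)) 0 *
        (((fun _ => (1 : Polynomial ℂ)) j).natDegree : ℝ) <
      (X j : MvPolynomial (Fin 2) ℂ).totalDegree := by
    intro j
    rw [hsum, hdeg]
    simp only [Polynomial.natDegree_one, Nat.cast_zero, mul_zero, add_zero, Nat.cast_one]
    norm_num
  have hr : ∃ i : Fin 2, Irrational ((![Real.sqrt 2, 1 / 2 - Real.sqrt 2] : Fin 2 → ℝ) i) :=
    ⟨0, by simpa using irrational_sqrt_two⟩
  exact polyFibredGraph_hyperplane_member_dense _ 0 hr _ hA (fun _ => 1) hlam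

end Example

end Summit.Schanuel.Schanuel.Theorems

end
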